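import Mathlib
import HarnessLib
import Summits.Parity.BatemanHorn.Theorems.AlmostPrimeZerosSystemZeroRepulsionLongCyclesLatticeCount

/-!
# The long-cycle polynomials of the symmetric groups: real simple negative zeros and left lattice
domination for `m₀ = 1` (crux stmt-Parity-11291, line `buchstab-flow-hyperbolicity`, stub
`LongCyclesLattice`, part 4 — the permutation bridge and the `m₀ = 1` case of the registered stub)

Everything here is PROVED (theorems only).  `L_n(X) := Σ_{σ ∈ S_n} X^{#cycles of σ of length ≥ 2}`
(Mathlib: `Multiset.card σ.cycleType`) satisfies `L_0 = L_1 = 1` and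
`L_{n+2} = (n+2)·L_{n+1} + (n+1)·(X − 1)·L_n` (`longCycle_recurrence`): decompose `S_{n+2}` by
`Equiv.Perm.decomposeFin` — the new point is either fixed (cycle count unchanged: the lift is an
`extendDomain`, `cycleType_extendDomain`), or transposed with a fixed point `i` of the rest (one more
2-cycle: disjoint product), or inserted into the cycle through `i` (same count: removing a point from
a cycle of length `≥ 3`, `IsCycle.swap_mul` + `cycleFactorsFinset_mul_inv_mem_eq_sdiff`), and the
fixed-point-weighted sum is `(n+1)·(X−1)·L_n` by conjugation to the point `0`.  Hence parts 1–3
(`rec_realRooted`, `rec_latticeDominated`) apply: `longCyclesLattice_one` is the `m₀ = 1` case of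
the line's registered stub `stub_longCyclesLattice` VERBATIM (the filter `1 < l` on `cycleType` is
the identity).  The general case `m₀ ≥ 2` ((m₀+1)-term recurrence) is not treated here.
-/

open Polynomial Finset Equiv Equiv.Perm

namespace Summit.Parity.BatemanHorn.Cruxes.SystemZeroRepulsion.BuchstabFlowHyperbolicity


/-- The lift of `e : Perm (Fin n)` fixing `0` is `extendDomain` along `succAbove 0`. -/
theorem decomposeFin_symm_zero_eq_extendDomain {n : ℕ} (e : Perm (Fin n)) :
    Equiv.Perm.decomposeFin.symm (0, e) = e.extendDomain (finSuccAboveEquiv 0) := by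
  ext x
  refine Fin.cases ?_ (fun i => ?_) x
  · rw [Equiv.Perm.decomposeFin_symm_apply_zero,
      Equiv.Perm.extendDomain_apply_not_subtype _ _ (by simp)]
  · rw [Equiv.Perm.decomposeFin_symm_apply_succ, Equiv.swap_self, Equiv.refl_apply]
    have h1 : (i.succ : Fin (n + 1)) = ((finSuccAboveEquiv 0) i : {x : Fin (n + 1) // x ≠ 0}) := by
      rw [finSuccAboveEquiv_apply]; simp
    have h2 : ((e i).succ : Fin (n + 1)) = ((finSuccAboveEquiv 0) (e i) : {x : Fin (n + 1) // x ≠ 0}) := by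
      rw [finSuccAboveEquiv_apply]; simp
    rw [h1, Equiv.Perm.extendDomain_apply_image, ← h2]

/-- Cycle type of the lift. -/
theorem cycleType_decomposeFin_symm_zero {n : ℕ} (e : Perm (Fin n)) :
    (Equiv.Perm.decomposeFin.symm (0, e)).cycleType = e.cycleType := by
  rw [decomposeFin_symm_zero_eq_extendDomain, cycleType_extendDomain]

/-- `decomposeFin.symm (p, e) = swap 0 p * lift e`. -/
theorem decomposeFin_symm_eq_swap_mul {n : ℕ} (p : Fin (n + 1)) (e : Perm (Fin n)) :
    Equiv.Perm.decomposeFin.symm (p, e) = swap 0 p * Equiv.Perm.decomposeFin.symm (0, e) := by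
  ext x
  refine Fin.cases ?_ (fun i => ?_) x
  · simp [Equiv.Perm.decomposeFin_symm_apply_zero]
  · simp [Equiv.Perm.decomposeFin_symm_apply_succ]

/-- The lift fixes `0` and sends `i.succ` to `(e i).succ`. -/
theorem lift_apply_succ {n : ℕ} (e : Perm (Fin n)) (i : Fin n) :
    Equiv.Perm.decomposeFin.symm (0, e) i.succ = (e i).succ := by
  simp [Equiv.Perm.decomposeFin_symm_apply_succ]

/-- The lift fixes `0`. -/
theorem lift_apply_zero {n : ℕ} (e : Perm (Fin n)) :
    Equiv.Perm.decomposeFin.symm (0, e) 0 = 0 := by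
  simp

/-- Case `e i = i`: the new element makes a 2-cycle with `i.succ`, one more cycle. -/
theorem card_cycleType_decomposeFin_symm_of_fixed {n : ℕ} (e : Perm (Fin n)) (i : Fin n) (hi : e i = i) :
    Multiset.card (Equiv.Perm.decomposeFin.symm (i.succ, e)).cycleType = Multiset.card e.cycleType + 1 := by
  rw [decomposeFin_symm_eq_swap_mul]
  set τ := Equiv.Perm.decomposeFin.symm (0, e) with hτ
  have hdisj : Disjoint (swap (0 : Fin (n + 1)) i.succ) τ := by
    intro x
    by_cases hx0 : x = 0
    · right; rw [hx0, hτ, lift_apply_zero]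
    · by_cases hxi : x = i.succ
      · right; rw [hxi, hτ, lift_apply_succ, hi]
      · left; rw [swap_apply_of_ne_of_ne hx0 hxi]
  rw [hdisj.cycleType_mul, Multiset.card_add, hτ, cycleType_decomposeFin_symm_zero]
  have hsw : (swap (0 : Fin (n + 1)) i.succ).cycleType = {2} :=
    isSwap_iff_cycleType.mp ⟨0, i.succ, (Fin.succ_ne_zero i).symm, rfl⟩
  rw [hsw]
  simp [add_comm]

/-- Number of nontrivial cycles = number of cycle factors. -/
theorem card_cycleType_eq_card_cycleFactorsFinset {α : Type*} [Fintype α] [DecidableEq α] (σ : Perm α) :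
    Multiset.card σ.cycleType = σ.cycleFactorsFinset.card := by
  rw [cycleType_def, Multiset.card_map, Finset.card_val]

/-- Removing a point from a cycle of length `≥ 3` keeps the number of cycles: if `σ x ≠ x` and
`σ (σ x) ≠ x` then `swap x (σ x) * σ` has as many nontrivial cycles as `σ`. -/
theorem card_cycleType_swap_mul_self {α : Type*} [Fintype α] [DecidableEq α] (σ : Perm α) (x : α)
    (hx : σ x ≠ x) (hxx : σ (σ x) ≠ x) :
    Multiset.card (swap x (σ x) * σ).cycleType = Multiset.card σ.cycleType := by
  classical
  set c := σ.cycleOf x with hc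
  have hcmem : c ∈ σ.cycleFactorsFinset := cycleOf_mem_cycleFactorsFinset_iff.mpr (mem_support.mpr hx)
  have hcyc : IsCycle c := isCycle_cycleOf σ hx
  set ρ := σ * c⁻¹ with hρ
  have hdisj : Disjoint ρ c := disjoint_mul_inv_of_mem_cycleFactorsFinset hcmem
  have hσ : σ = c * ρ := by
    rw [hdisj.commute.eq.symm, hρ, inv_mul_cancel_right]
  have hρfac : ρ.cycleFactorsFinset = σ.cycleFactorsFinset \ {c} := cycleFactorsFinset_mul_inv_mem_eq_sdiff hcmem
  have hcard_σ : σ.cycleFactorsFinset.card = ρ.cycleFactorsFinset.card + 1 := by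
    rw [hρfac, Finset.card_sdiff_of_subset (Finset.singleton_subset_iff.mpr hcmem), Finset.card_singleton]
    have : 1 ≤ σ.cycleFactorsFinset.card := Finset.card_pos.mpr ⟨c, hcmem⟩
    omega
  have hc0 : c x = σ x := by rw [hc, cycleOf_apply_self]
  have hcc0 : c (c x) = σ (σ x) := by rw [hc0, hc, cycleOf_apply_apply_self]
  -- the shortened cycle
  have hcyc' : IsCycle (swap x (c x) * c) := hcyc.swap_mul (by rw [hc0]; exact hx) (by rw [hcc0]; exact hxx)
  have hsupp' : (swap x (c x) * c).support ≤ c.support := by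
    refine (support_mul_le _ _).trans (sup_le ?_ le_rfl)
    intro y hy
    rw [support_swap (by rw [hc0]; exact hx.symm)] at hy
    simp only [Finset.mem_insert, Finset.mem_singleton] at hy
    rcases hy with rfl | rfl
    · exact mem_support.mpr (by rw [hc0]; exact hx)
    · exact mem_support.mpr (by rw [hcc0, hc0]; intro h; exact hx (σ.injective h))
  have hdisj' : Disjoint (swap x (c x) * c) ρ := (hdisj.symm.mono hsupp' le_rfl)
  -- assemble
  have hτ : swap x (σ x) * σ = (swap x (c x) * c) * ρ := by rw [mul_assoc, ← hσ, hc0]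
  rw [hτ, hdisj'.cycleType_mul, Multiset.card_add, card_cycleType_eq_one.mpr hcyc',
    card_cycleType_eq_card_cycleFactorsFinset σ, card_cycleType_eq_card_cycleFactorsFinset ρ, hcard_σ, add_comm]

/-- Case `e i ≠ i`: the new element is inserted into the cycle of `i.succ`; same number of cycles. -/
theorem card_cycleType_decomposeFin_symm_of_not_fixed {n : ℕ} (e : Perm (Fin n)) (i : Fin n) (hi : e i ≠ i) :
    Multiset.card (Equiv.Perm.decomposeFin.symm (i.succ, e)).cycleType = Multiset.card e.cycleType := by
  set σ := Equiv.Perm.decomposeFin.symm (i.succ, e) with hσ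
  set τ := Equiv.Perm.decomposeFin.symm (0, e) with hτ
  have hστ : σ = swap 0 i.succ * τ := decomposeFin_symm_eq_swap_mul _ _
  have hσ0 : σ 0 = i.succ := by rw [hσ]; simp
  have hσi : σ i.succ = (e i).succ := by
    rw [hστ, Perm.mul_apply, hτ, lift_apply_succ, swap_apply_of_ne_of_ne (Fin.succ_ne_zero _)]
    exact fun h => hi (Fin.succ_injective _ h)
  have hx : σ 0 ≠ 0 := by rw [hσ0]; exact Fin.succ_ne_zero i
  have hxx : σ (σ 0) ≠ 0 := by rw [hσ0, hσi]; exact Fin.succ_ne_zero _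
  have hτσ : τ = swap 0 (σ 0) * σ := by rw [hσ0, hστ, swap_mul_self_mul]
  rw [← cycleType_decomposeFin_symm_zero e, ← hτ, hτσ, card_cycleType_swap_mul_self σ 0 hx hxx]

/-! ### The recurrence for `L n = Σ_σ X^{#cycles}` -/

/-- Unified count: `#cycles (decomposeFin.symm (i.succ, e)) = #cycles e + [e i = i]`. -/
theorem card_cycleType_decomposeFin_symm_succ {n : ℕ} (e : Perm (Fin n)) (i : Fin n) :
    Multiset.card (Equiv.Perm.decomposeFin.symm (i.succ, e)).cycleType =
      Multiset.card e.cycleType + (if e i = i then 1 else 0) := by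
  by_cases hi : e i = i
  · rw [if_pos hi, card_cycleType_decomposeFin_symm_of_fixed e i hi]
  · rw [if_neg hi, add_zero, card_cycleType_decomposeFin_symm_of_not_fixed e i hi]

/-- Permutations fixing `i`, summed with a cycle-type-invariant weight, equal permutations fixing `0`. -/
theorem sum_fixing_eq_sum_fixing_zero {n : ℕ} (i : Fin (n + 1)) (g : Perm (Fin (n + 1)) → ℝ[X])
    (hg : ∀ σ τ : Perm (Fin (n + 1)), g (τ * σ * τ⁻¹) = g σ) :
    ∑ e, (if e i = i then g e else 0) = ∑ e, (if e 0 = 0 then g e else 0) := by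
  set τ : Perm (Fin (n + 1)) := swap 0 i with hτ
  have hτinv : τ⁻¹ = τ := by rw [hτ, swap_inv]
  -- reindex by conjugation with τ
  have hbij : Function.Bijective fun e : Perm (Fin (n + 1)) => τ * e * τ⁻¹ :=
    (MulAut.conj τ).bijective
  rw [← Function.Bijective.sum_comp hbij fun e => if e i = i then g e else 0]
  refine Finset.sum_congr rfl fun e _ => ?_
  have h1 : (τ * e * τ⁻¹) i = i ↔ e 0 = 0 := by
    rw [hτinv, Perm.mul_apply, Perm.mul_apply, hτ, swap_apply_right]
    constructor
    · intro h
      have := congrArg (swap (0 : Fin (n + 1)) i) h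
      rwa [swap_apply_self, swap_apply_right] at this
    · intro h; rw [h, swap_apply_left]
  simp only [h1, hg]

/-- Permutations of `Fin (n+1)` fixing `0` are the lifts of `Perm (Fin n)`. -/
theorem sum_fixing_zero_eq {n : ℕ} (g : Perm (Fin (n + 1)) → ℝ[X]) :
    ∑ e, (if e 0 = 0 then g e else 0) = ∑ e' : Perm (Fin n), g (Equiv.Perm.decomposeFin.symm (0, e')) := by
  have h1 : ∑ e : Perm (Fin (n + 1)), (if e 0 = 0 then g e else 0) =
      ∑ q : Fin (n + 1) × Perm (Fin n), (if (Equiv.Perm.decomposeFin.symm q) 0 = 0 then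
        g (Equiv.Perm.decomposeFin.symm q) else 0) := by
    rw [← Equiv.sum_comp Equiv.Perm.decomposeFin.symm]
  rw [h1, Fintype.sum_prod_type, Fin.sum_univ_succ]
  simp only [Equiv.Perm.decomposeFin_symm_apply_zero, if_true, Fin.succ_ne_zero, if_false,
    Finset.sum_const_zero, add_zero]

/-- **The recurrence**: `L (n+2) = (n+2)·L (n+1) + (n+1)·(X − 1)·L n` for `L n = Σ_{σ ∈ S_n} X^{#cycles}`. -/
theorem longCycle_recurrence (n : ℕ) :
    (∑ σ : Perm (Fin (n + 2)), (X : ℝ[X]) ^ Multiset.card σ.cycleType) =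
      C ((n : ℝ) + 2) * (∑ σ : Perm (Fin (n + 1)), (X : ℝ[X]) ^ Multiset.card σ.cycleType) +
        C ((n : ℝ) + 1) * (X - 1) * (∑ σ : Perm (Fin n), (X : ℝ[X]) ^ Multiset.card σ.cycleType) := by
  -- decompose S_{n+2} by `decomposeFin`
  have hdec : (∑ σ : Perm (Fin (n + 2)), (X : ℝ[X]) ^ Multiset.card σ.cycleType) =
      ∑ q : Fin (n + 2) × Perm (Fin (n + 1)), (X : ℝ[X]) ^ Multiset.card (Equiv.Perm.decomposeFin.symm q).cycleType := by
    rw [← Equiv.sum_comp Equiv.Perm.decomposeFin.symm]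
  rw [hdec, Fintype.sum_prod_type, Fin.sum_univ_succ]
  simp only [cycleType_decomposeFin_symm_zero, card_cycleType_decomposeFin_symm_succ]
  -- Σ_i Σ_e X^{c e + [e i = i]} = Σ_e (n+1) X^{c e} + (X - 1) Σ_e fix(e) X^{c e}
  have hswap : ∑ i : Fin (n + 1), ∑ e : Perm (Fin (n + 1)),
      (X : ℝ[X]) ^ (Multiset.card e.cycleType + if e i = i then 1 else 0) =
      ∑ e : Perm (Fin (n + 1)), ∑ i : Fin (n + 1),
        ((X : ℝ[X]) ^ Multiset.card e.cycleType + (if e i = i then (X - 1) * X ^ Multiset.card e.cycleType else 0)) := by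
    rw [Finset.sum_comm]
    refine Finset.sum_congr rfl fun e _ => Finset.sum_congr rfl fun i _ => ?_
    split_ifs with h
    · ring
    · rw [add_zero, add_zero]
  rw [hswap]
  simp only [Finset.sum_add_distrib, Finset.sum_const, Finset.card_univ, Fintype.card_fin]
  -- the fixed-point sum: Σ_e Σ_i [e i = i] (X-1) X^{c e} = (n+1) (X - 1) L n
  have hfix : ∑ e : Perm (Fin (n + 1)), ∑ i : Fin (n + 1),
      (if e i = i then (X - 1) * (X : ℝ[X]) ^ Multiset.card e.cycleType else 0) =
      ((n : ℝ[X]) + 1) * ((X - 1) * ∑ σ : Perm (Fin n), (X : ℝ[X]) ^ Multiset.card σ.cycleType) := by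
    rw [Finset.sum_comm]
    have hinner : ∀ i : Fin (n + 1), ∑ e : Perm (Fin (n + 1)),
        (if e i = i then (X - 1) * (X : ℝ[X]) ^ Multiset.card e.cycleType else 0) =
        (X - 1) * ∑ σ : Perm (Fin n), (X : ℝ[X]) ^ Multiset.card σ.cycleType := by
      intro i
      rw [sum_fixing_eq_sum_fixing_zero i (fun e => (X - 1) * (X : ℝ[X]) ^ Multiset.card e.cycleType)
        (fun σ τ => by simp only [cycleType_conj]), sum_fixing_zero_eq, Finset.mul_sum]
      simp only [cycleType_decomposeFin_symm_zero]
    simp only [hinner, Finset.sum_const, Finset.card_univ, Fintype.card_fin]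
    rw [nsmul_eq_mul]
    push_cast
    ring
  rw [hfix, ← Finset.smul_sum, nsmul_eq_mul]
  simp only [map_add, map_natCast, map_one, map_ofNat]
  push_cast
  ring

/-- `L 0 = 1`. -/
theorem longCycle_zero : (∑ σ : Perm (Fin 0), (X : ℝ[X]) ^ Multiset.card σ.cycleType) = 1 := by
  rw [Fintype.sum_subsingleton _ 1, cycleType_one]; simp

/-- `L 1 = 1`. -/
theorem longCycle_one : (∑ σ : Perm (Fin 1), (X : ℝ[X]) ^ Multiset.card σ.cycleType) = 1 := by
  rw [Fintype.sum_subsingleton _ 1, cycleType_one]; simp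


/-- **`LongCyclesLattice` for `m₀ = 1` (the `m₀ = 1` instance of the registered stub, verbatim).**
For every `n`, the long-cycle polynomial `Σ_{σ ∈ S_n} X^{#cycles of length > 1}` has only real zeros
(`roots.card = natDegree`) and for every `m : ℕ` at most `m` of them satisfy `|1 − ρ| < m + 1`. -/
theorem longCyclesLattice_one : ∀ n : ℕ,
    (∑ σ : Equiv.Perm (Fin n), (Polynomial.X : Polynomial ℝ) ^
        Multiset.card (σ.cycleType.filter fun l => 1 < l)).roots.card =
      (∑ σ : Equiv.Perm (Fin n), (Polynomial.X : Polynomial ℝ) ^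
        Multiset.card (σ.cycleType.filter fun l => 1 < l)).natDegree ∧
    ∀ m : ℕ, ((∑ σ : Equiv.Perm (Fin n), (Polynomial.X : Polynomial ℝ) ^
        Multiset.card (σ.cycleType.filter fun l => 1 < l)).roots.filter
          fun ρ : ℝ => |1 - ρ| < (m : ℝ) + 1).card ≤ m := by
  have hfilt : ∀ (k : ℕ) (σ : Equiv.Perm (Fin k)), Multiset.card (σ.cycleType.filter fun l => 1 < l) =
      Multiset.card σ.cycleType := fun k σ => by
    rw [Multiset.filter_eq_self.mpr fun l hl => one_lt_of_mem_cycleType hl]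
  have hL : ∀ k : ℕ, (∑ σ : Equiv.Perm (Fin k), (Polynomial.X : Polynomial ℝ) ^
      Multiset.card (σ.cycleType.filter fun l => 1 < l)) =
      ∑ σ : Equiv.Perm (Fin k), (Polynomial.X : Polynomial ℝ) ^ Multiset.card σ.cycleType := fun k =>
    Finset.sum_congr rfl fun σ _ => by rw [hfilt]
  intro n
  rw [hL n]
  set R : ℕ → ℝ[X] := fun k => ∑ σ : Equiv.Perm (Fin k), (Polynomial.X : Polynomial ℝ) ^ Multiset.card σ.cycleType
    with hR
  have h0 : R 0 = 1 := longCycle_zero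
  have h1 : R 1 = 1 := longCycle_one
  have hrec : ∀ k : ℕ, R (k + 2) = C ((k : ℝ) + 2) * R (k + 1) + C ((k : ℝ) + 1) * (X - 1) * R k :=
    fun k => longCycle_recurrence k
  obtain ⟨hcard, -, -⟩ := rec_realRooted R h0 h1 hrec n
  exact ⟨hcard, fun m => rec_latticeDominated R h0 h1 hrec n m⟩

end Summit.Parity.BatemanHorn.Cruxes.SystemZeroRepulsion.BuchstabFlowHyperbolicity
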